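import Summits.RiemannHypothesis.RiemannHypothesis.Theorems.WeilFormatCPolyWindowPole
import Summits.RiemannHypothesis.RiemannHypothesis.Theorems.WeilFormatCPolyWindowConstantsBox
import HarnessLib

/-!
# Format C, design C∞ — (E) side II-a: kernel enclosures of the pole data `C_j`, `S_j` and of `POLE_{jk} = 2C_jC_k − 2S_jS_k`

Route context: Fourier–Galerkin / Schur-complement certificates of Weil positivity on a window ("format C", design C∞;
`run/shared/lean/pub/rh-explicit/rh-explicit-weil-10/KERNEL-LEVER.md` §17; supporting stmt-RiemannHypothesis-0098; seats
rh-explicit-weil-2 / weil-10).  The pole term of the monomial-window entry `W_a(1x^j, 1x^k)`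
(`WeilFormatCPolyWindowEntry.weilWindowSesq_indicator_pow`) is `2C_jC_k − 2S_jS_k` with the moments
`C_j = ∫_{−a}^{a} x^j cosh(x/2) dx`, `S_j = ∫_{−a}^{a} x^j sinh(x/2) dx` (`WeilFormatCPolyWindowPole.lean`).  For a RATIONAL
window `a` the Laplace moments `∫_{−a}^{a} x^j e^{cx} dx` (`c = ±½`) are `p_j(c)·e^{ca} − q_j(c)·e^{−ca}` with RATIONAL
`p_j, q_j` (`integral_pow_mul_exp_eq_lap`, from `integral_pow_mul_exp_eq_sum`), so `C_j = α_j e^{a/2} + β_j e^{−a/2}`,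
`S_j = σ_j e^{a/2} + τ_j e^{−a/2}` with rational `α, β, σ, τ` (`coshCoeffA/B`, `sinhCoeffA/B`); the boxes
`coshMomBox`, `sinhMomBox`, `poleBox` multiply two input boxes `E⁺ ∋ e^{a/2}`, `E⁻ ∋ e^{−a/2}` by these rationals
(`mem_coshMomBox`, `mem_sinhMomBox`, **`mem_poleBox`**); `expHalfBoxes` produces `E^{±}` by `MI.exp`.  Also the window moments
`m_n = (a^{n+1} − (−a)^{n+1})/(n+1) ∈ ℚ` (`momentQ`, `momentQ_cast`).  Interval plumbing; standard axioms; no RH claim.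
-/

set_option autoImplicit false
-- `Summit.RiemannHypothesis.RiemannHypothesis.…` is the layout-mandated namespace (summit = problem name).
set_option linter.dupNamespace false

open Complex Filter Set MeasureTheory Finset
open scoped Real Topology

namespace Summit.RiemannHypothesis.RiemannHypothesis.Theorems.WeilFormatC

open Literature.NumberTheory.LFunctions Literature.Analysis.SpecialFunctions
open Literature.Analysis.ValidatedNumerics Literature.Analysis.ValidatedNumerics.NumericsMP

namespace WinPole

open WinConst (ratBox mem_ratBox mulRatBox mem_mulRatBox)

/-! ## Rational Laplace-moment coefficients -/

/-- `p_j(c) = Σ_{k≤j} (−1)^k j^{(k)} a^{j−k}/c^{k+1}` (coefficient of `e^{ca}` in `∫_{−a}^{a} x^j e^{cx}`). -/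
def lapP (a c : ℚ) (j : ℕ) : ℚ :=
  ∑ k ∈ Finset.range (j + 1), (-1) ^ k * (j.descFactorial k : ℚ) * a ^ (j - k) / c ^ (k + 1)

/-- `q_j(c) = Σ_{k≤j} (−1)^k j^{(k)} (−a)^{j−k}/c^{k+1}` (coefficient of `−e^{−ca}` in `∫_{−a}^{a} x^j e^{cx}`). -/
def lapM (a c : ℚ) (j : ℕ) : ℚ :=
  ∑ k ∈ Finset.range (j + 1), (-1) ^ k * (j.descFactorial k : ℚ) * (-a) ^ (j - k) / c ^ (k + 1)

/-- **Laplace moments through the rational coefficients**: for rational `a` and `c ≠ 0`,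
`∫_{−a}^{a} x^j e^{cx} dx = p_j(c) e^{ca} − q_j(c) e^{−ca}`. -/
theorem integral_pow_mul_exp_eq_lap (a : ℚ) {c : ℚ} (hc : c ≠ 0) (j : ℕ) :
    ∫ x in (-(a : ℝ))..(a : ℝ), x ^ j * Real.exp ((c : ℝ) * x) =
      (lapP a c j : ℝ) * Real.exp ((c : ℝ) * a) - (lapM a c j : ℝ) * Real.exp (-((c : ℝ) * a)) := by
  have hc' : (c : ℝ) ≠ 0 := by exact_mod_cast hc
  rw [integral_pow_mul_exp_eq_sum hc' j, lapP, lapM]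
  push_cast
  rw [Finset.sum_mul, Finset.sum_mul, ← Finset.sum_sub_distrib]
  refine Finset.sum_congr rfl fun k _ ↦ ?_
  rw [show (c : ℝ) * (-(a : ℝ)) = -((c : ℝ) * a) by ring]
  ring

/-- `α_j`: coefficient of `e^{a/2}` in `C_j`. -/
def coshCoeffA (a : ℚ) (j : ℕ) : ℚ := (lapP a (1 / 2) j - lapM a (-(1 / 2)) j) / 2
/-- `β_j`: coefficient of `e^{−a/2}` in `C_j`. -/
def coshCoeffB (a : ℚ) (j : ℕ) : ℚ := (lapP a (-(1 / 2)) j - lapM a (1 / 2) j) / 2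
/-- `σ_j`: coefficient of `e^{a/2}` in `S_j`. -/
def sinhCoeffA (a : ℚ) (j : ℕ) : ℚ := (lapP a (1 / 2) j + lapM a (-(1 / 2)) j) / 2
/-- `τ_j`: coefficient of `e^{−a/2}` in `S_j`. -/
def sinhCoeffB (a : ℚ) (j : ℕ) : ℚ := (-lapM a (1 / 2) j - lapP a (-(1 / 2)) j) / 2

/-- **`C_j = α_j e^{a/2} + β_j e^{−a/2}`** (rational window). -/
theorem integral_pow_mul_cosh_half_eq_coeff (a : ℚ) (j : ℕ) :
    ∫ x in (-(a : ℝ))..(a : ℝ), x ^ j * Real.cosh (x / 2) =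
      (coshCoeffA a j : ℝ) * Real.exp ((a : ℝ) / 2) + (coshCoeffB a j : ℝ) * Real.exp (-((a : ℝ) / 2)) := by
  have h1 := integral_pow_mul_exp_eq_lap a (c := 1 / 2) (by norm_num) j
  have h2 := integral_pow_mul_exp_eq_lap a (c := -(1 / 2)) (by norm_num) j
  rw [integral_pow_mul_cosh_half, coshCoeffA, coshCoeffB]
  push_cast at h1 h2 ⊢
  rw [h1, h2]
  rw [show -(-(1 / 2) * (a : ℝ)) = (a : ℝ) / 2 by ring, show -(1 / 2) * (a : ℝ) = -((a : ℝ) / 2) by ring,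
    show (1 / 2 : ℝ) * (a : ℝ) = (a : ℝ) / 2 by ring]
  ring

/-- **`S_j = σ_j e^{a/2} + τ_j e^{−a/2}`** (rational window). -/
theorem integral_pow_mul_sinh_half_eq_coeff (a : ℚ) (j : ℕ) :
    ∫ x in (-(a : ℝ))..(a : ℝ), x ^ j * Real.sinh (x / 2) =
      (sinhCoeffA a j : ℝ) * Real.exp ((a : ℝ) / 2) + (sinhCoeffB a j : ℝ) * Real.exp (-((a : ℝ) / 2)) := by
  have h1 := integral_pow_mul_exp_eq_lap a (c := 1 / 2) (by norm_num) j
  have h2 := integral_pow_mul_exp_eq_lap a (c := -(1 / 2)) (by norm_num) j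
  rw [integral_pow_mul_sinh_half, sinhCoeffA, sinhCoeffB]
  push_cast at h1 h2 ⊢
  rw [h1, h2]
  rw [show -(-(1 / 2) * (a : ℝ)) = (a : ℝ) / 2 by ring, show -(1 / 2) * (a : ℝ) = -((a : ℝ) / 2) by ring,
    show (1 / 2 : ℝ) * (a : ℝ) = (a : ℝ) / 2 by ring]
  ring

/-- The window moments `m_n = ∫_{−a}^{a} x^n = (a^{n+1} − (−a)^{n+1})/(n+1)` as rationals. -/
def momentQ (a : ℚ) (n : ℕ) : ℚ := (a ^ (n + 1) - (-a) ^ (n + 1)) / (n + 1)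

/-- `momentQ` cast to `ℝ`. -/
theorem momentQ_cast (a : ℚ) (n : ℕ) :
    (momentQ a n : ℝ) = ((a : ℝ) ^ (n + 1) - (-(a : ℝ)) ^ (n + 1)) / (n + 1) := by
  rw [momentQ]; push_cast; ring

/-! ## The boxes -/

/-- `E⁺ ∋ e^{a/2}` and `E⁻ ∋ e^{−a/2}` by the interval exponential. -/
def expHalfBoxes (S Kser kred : ℕ) (a : ℚ) : Option (MI × MI) :=
  match MI.exp S Kser kred (ratBox S (a / 2)), MI.exp S Kser kred (ratBox S (-(a / 2))) with
  | some Ep, some Em => some (Ep, Em)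
  | _, _ => none

/-- `expHalfBoxes` encloses `(e^{a/2}, e^{−a/2})`. -/
theorem mem_expHalfBoxes {S : ℕ} (hS : 0 < S) {Kser kred : ℕ} {a : ℚ} {Ep Em : MI}
    (h : expHalfBoxes S Kser kred a = some (Ep, Em)) :
    MI.mem S (Real.exp ((a : ℝ) / 2)) Ep ∧ MI.mem S (Real.exp (-((a : ℝ) / 2))) Em := by
  unfold expHalfBoxes at h
  split at h
  · rename_i A B hA hB
    simp only [Option.some.injEq, Prod.mk.injEq] at h
    obtain ⟨rfl, rfl⟩ := h
    refine ⟨?_, ?_⟩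
    · have := MI.mem_exp hS hA (mem_ratBox S (a / 2)); convert this using 2; push_cast; ring
    · have := MI.mem_exp hS hB (mem_ratBox S (-(a / 2))); convert this using 2; push_cast; ring
  · simp at h

/-- Box of `C_j = α_j e^{a/2} + β_j e^{−a/2}`. -/
def coshMomBox (Ep Em : MI) (a : ℚ) (j : ℕ) : MI :=
  (mulRatBox Ep (coshCoeffA a j)).add (mulRatBox Em (coshCoeffB a j))

/-- Box of `S_j = σ_j e^{a/2} + τ_j e^{−a/2}`. -/
def sinhMomBox (Ep Em : MI) (a : ℚ) (j : ℕ) : MI :=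
  (mulRatBox Ep (sinhCoeffA a j)).add (mulRatBox Em (sinhCoeffB a j))

variable {S : ℕ} {a : ℚ} {Ep Em : MI}

/-- `coshMomBox ∋ C_j`. -/
theorem mem_coshMomBox (hEp : MI.mem S (Real.exp ((a : ℝ) / 2)) Ep) (hEm : MI.mem S (Real.exp (-((a : ℝ) / 2))) Em)
    (j : ℕ) : MI.mem S (∫ x in (-(a : ℝ))..(a : ℝ), x ^ j * Real.cosh (x / 2)) (coshMomBox Ep Em a j) := by
  rw [integral_pow_mul_cosh_half_eq_coeff, coshMomBox, mul_comm (coshCoeffA a j : ℝ), mul_comm (coshCoeffB a j : ℝ)]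
  exact MI.mem_add (mem_mulRatBox hEp _) (mem_mulRatBox hEm _)

/-- `sinhMomBox ∋ S_j`. -/
theorem mem_sinhMomBox (hEp : MI.mem S (Real.exp ((a : ℝ) / 2)) Ep) (hEm : MI.mem S (Real.exp (-((a : ℝ) / 2))) Em)
    (j : ℕ) : MI.mem S (∫ x in (-(a : ℝ))..(a : ℝ), x ^ j * Real.sinh (x / 2)) (sinhMomBox Ep Em a j) := by
  rw [integral_pow_mul_sinh_half_eq_coeff, sinhMomBox, mul_comm (sinhCoeffA a j : ℝ), mul_comm (sinhCoeffB a j : ℝ)]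
  exact MI.mem_add (mem_mulRatBox hEp _) (mem_mulRatBox hEm _)

/-- Box of the pole term `POLE_{jk} = 2C_jC_k − 2S_jS_k`. -/
def poleBox (S : ℕ) (Ep Em : MI) (a : ℚ) (j k : ℕ) : MI :=
  (((coshMomBox Ep Em a j).mul S (coshMomBox Ep Em a k)).mulInt 2).sub
    (((sinhMomBox Ep Em a j).mul S (sinhMomBox Ep Em a k)).mulInt 2)

/-- **`poleBox ∋ 2C_jC_k − 2S_jS_k`** (the pole term of `weilWindowSesq_indicator_pow`). -/
theorem mem_poleBox (hS : 0 < S) (hEp : MI.mem S (Real.exp ((a : ℝ) / 2)) Ep)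
    (hEm : MI.mem S (Real.exp (-((a : ℝ) / 2))) Em) (j k : ℕ) :
    MI.mem S (2 * (∫ x in (-(a : ℝ))..(a : ℝ), x ^ j * Real.cosh (x / 2)) *
          (∫ x in (-(a : ℝ))..(a : ℝ), x ^ k * Real.cosh (x / 2)) -
        2 * (∫ x in (-(a : ℝ))..(a : ℝ), x ^ j * Real.sinh (x / 2)) *
          (∫ x in (-(a : ℝ))..(a : ℝ), x ^ k * Real.sinh (x / 2))) (poleBox S Ep Em a j k) := by
  have hC := MI.mem_mulInt (MI.mem_mul hS (mem_coshMomBox hEp hEm j) (mem_coshMomBox hEp hEm k)) 2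
  have hSS := MI.mem_mulInt (MI.mem_mul hS (mem_sinhMomBox hEp hEm j) (mem_sinhMomBox hEp hEm k)) 2
  have h := MI.mem_sub hC hSS
  rw [poleBox]
  convert h using 1
  push_cast
  ring

end WinPole

end Summit.RiemannHypothesis.RiemannHypothesis.Theorems.WeilFormatC
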